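import Summits.QuantumFields.BalabanUV.T4Continuum.Support.NE7QbarCurvedBaseLetter
import Summits.QuantumFields.BalabanUV.T4Continuum.Support.NE7MajorantL1
import Summits.QuantumFields.BalabanUV.T4Continuum.Support.NE3CovariantLineSumsTower
import Summits.QuantumFields.BalabanUV.T4Continuum.Support.AveragingDeficitFermat
import HarnessLib

/-!
# NE7QbarCurvedBaseTower — THE `ℓ¹` BASE-LIPSCHITZ LETTER OF THE STRAIGHT (DOUBLE-BAR) TOWER AT A CURVED BACKGROUND, k-UNIFORM:
# `Σ_{z∈[0,N)^d} Σ_κ ‖Q̄^{(j+1)}_U Y − Q̄^{(j+1)}_W Y‖ ≤ (L^d∕L)·Π_{i≤j} γ(x_i)·Σ_{i≤j} λ(r_i, x_i)·‖Y‖_{ℓ¹}` for two backgrounds of the multi-level class at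
# relative link radii `r_i` along the averaged pairs — hence `≤ K_maj·(L∕L^d)^j·Σ_{i≤j} λ(r_i, x_i)·‖Y‖_{ℓ¹}` — letter (L4) ROAD B of the curved (APE) programme, file 2

Cell `pub-balaban`, rung (B)+1 sub-cell t4, lineage `b2b-balaban-t4-ne7-p1` (CRUX PROVER NE7 #1 = OWNER of row NE7), generation 76; memo
`t4/b2b-balaban-t4-ne7-p1-g75/CURVED-APE-ROAD.md` §2 (L4) ROAD B.  File F68 (over F67 `NE7QbarCurvedBaseLetter.sum_norm_Qbar_sub_Qbar_le` (the one-level letter at a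
curved background), this lineage's `NE7MajorantL1` (`ℓ¹` norm of the single-background tower through the positive majorant: `NE3QbarIterMajorant.norm_QbarIter_le_majIter`,
`sum_periodBox_majIter_le`, `prod_step_le`), row NE3's `NE3CovariantLineSumsTower.QbarIter_add` (additivity through the tower), `NE3TangentCovariantTower` (`QbarIter_succ`,
`step_small`), `NE3TangentCovariantStructure.Qbar_add_period`, `AveragingDeficitFermat.isPeriodicCfg_cavg`).
WHY (memo §2 (L4)).  The curved (TT) letter needs `Λ` with `‖Q̄^{(j+1)}_U Y − Q̄^{(j+1)}_W Y‖_{ℓ¹} ≤ Λ‖Y‖_{ℓ¹}` for the representative `U = W e^{Z}` against its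
CURVED background `W`, `Λ = O(small·M^{1−d})` UNIFORMLY in the number of levels.  THIS FILE is the Grönwall over the levels, inner-first
(`Q̄^{(j+2)}_U Y = Q̄^{(j+1)}_{Ū}(Q̄_U Y)`): `Q̄^{(j+1)}_{Ū}(Q̄_U Y) − Q̄^{(j+1)}_{W̄}(Q̄_W Y) = Q̄^{(j+1)}_{Ū}(Q̄_U Y − Q̄_W Y) + (Q̄^{(j+1)}_{Ū} − Q̄^{(j+1)}_{W̄})(Q̄_W Y)`; the
first term costs the single-background `ℓ¹` norm of the tower at `Ū` (the majorant tower of `NE7MajorantL1`, no gauge condition) times F67's one-level letter `λ(r₀, x₀)`,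
the second the induction hypothesis times the one-level norm `γ(x₀)`.  The result `(L^d∕L)·Π_i γ(x_i)·Σ_i λ(r_i, x_i)` is bounded by `NE7MajorantL1.prod_step_le`:
`Π_{i≤j} γ(x_i) ≤ K_maj·(L∕L^d)^{j+1}` with the `j`-FREE `K_maj(d, L)`, so `Λ = K_maj·(L∕L^d)^j·Σ_{i≤j} λ(r_i, x_i)` — of the currency `M^{1−d}·O(b + α̂)` once the relative radii
`r_i` of the averaged pairs `(cavgIter i U, cavgIter i W)` are supplied (next file: `r_{i+1} ≤ L·r_i + O(x_i)` in the local axial gauge).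
WHAT ([folklore]; 0 def, 0 sorry).
§1 `one_le_invq_mul_gamma` (`1 ≤ (L^d∕L)·γ(x)`), `sum_norm_Qbar_le_gamma` (the one-level single-background `ℓ¹` norm `≤ γ(x)·‖Y‖₁` from the majorant),
   `sum_norm_QbarIter_le_prod` (the `(j+1)`-level single-background norm `≤ Π_{i≤j} γ(x_i)·‖Y‖₁`).
§2 **`sum_norm_QbarIter_sub_QbarIter_le`** — THE TOWER LETTER: `U`, `W` unitary, `(N·L^{j+1})`-periodic, `SmallField · x`, `LevelSmall d L j x`, relative link radii
   `‖(cavgIter i W)⁻¹(cavgIter i U) − 1‖ ≤ r_i` (`i ≤ j`), `Y` `(N·L^{j+1})`-periodic: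
   `Σ_{z∈[0,N)^d}Σ_κ ‖QbarIter L (j+1) U Y z κ − QbarIter L (j+1) W Y z κ‖ ≤ (L^d∕L)·Π_{i≤j} γ(x_i)·Σ_{i≤j} λ(r_i, x_i)·dirL1 Y (periodBox (N·L^{j+1}))`,
   `γ(x) = L∕L^d + d·wlin(x)·c_loc`, `λ(r, x) = d(2n_b+1)^d((2d+4)L²(2n_b x + r) + (8L + c_loc)·2loopRad(x))`, `x_i = prop1Radius^[i] x`.
§3 **`sum_norm_QbarIter_sub_QbarIter_le_Kmaj`** — the same `≤ K_maj·(L∕L^d)^j·Σ_{i≤j} λ(r_i, x_i)·‖Y‖₁` for `L ≥ 2`.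
HONEST FRAMING (page 1): lattice kinematics of the straight averaging tower; the relative radii `r_i`, the TT assembly and (APE) are NOT here; nothing of Bałaban's
asserted; NOT ONE-STEP, NOT NE7; spine 0∕9; finite T⁴ rung (B)+1 — NOT infinite volume, NOT mass gap, NOT `BetaPertH`, NOT Clay.  Continuum YM on T⁴ ⇐ BetaPertH ∧
nine spine estimates (0/9 proved); BetaPertH ⇐ (D1) ∧ (D4) ∧ CAP+tail; G-an2-4 gates asym, D1 and NE2/3/4.
-/

set_option autoImplicit false

open scoped BigOperators Matrix.Norms.L2Operator
open Finset

namespace Summit.QuantumFields.BalabanUV.T4Continuum.NE7QbarCurvedBaseTower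

open Literature.MathematicalPhysics.QuantumFieldTheory.Balaban1983to89
open B7Prop1Explicit B7Prop2Explicit
open T4AveragingDeficitWall (IsUnitaryCfg SmallField dirL1)
open T4AveragingDeficitWallBoundary (IsPeriodicCfg periodBox)
open AveragingDeficitPeriodicCounting (IsPeriodicDir)
open AveragingDeficitChartCalculus (cavg)
open AveragingDeficitTwoLevelPrep (prop1Radius twoLevelSmall)
open AveragingDeficitMultiLevelPrep (cavgIter LevelSmall prop1Radius_nonneg)
open AveragingDeficitFermat (isPeriodicCfg_cavg)
open SpreadLift (loopRad)
open BlockAverageVaryHolo (nbRad)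
open NE3TangentCovariantStructure (Qbar Qbar_add_period)
open NE3TangentCovariantTower (QbarIter QbarIter_succ QbarIter_one cavgIter_succ step_small)
open NE3QbarIterMajorant (wlin wlin_nonneg majIter norm_QbarIter_le_majIter)
open NE3CovariantLineSumsTower (QbarIter_add)
open NE7MajorantL1 (sum_periodBox_majIter_le prod_step_le iterate_prop1Radius_nonneg)
open NE7QbarCurvedBaseLetter (sum_norm_Qbar_sub_Qbar_le)

noncomputable section

variable {d : ℕ} {n : Type*} [Fintype n] [DecidableEq n]

/-! ## §1 The one-level norms -/

/-- `1 ≤ (L^d∕L)·(L∕L^d + t)` for `t ≥ 0`, `L ≥ 1`. [folklore] -/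
theorem one_le_invq_mul_gamma {L : ℕ} (hL : 1 ≤ L) {t : ℝ} (ht : 0 ≤ t) :
    1 ≤ ((L : ℝ) ^ d / L) * ((L : ℝ) / (L : ℝ) ^ d + t) := by
  have hL0 : (0 : ℝ) < L := by exact_mod_cast (show 0 < L by omega)
  have hLd : (0 : ℝ) < (L : ℝ) ^ d := by positivity
  rw [mul_add, div_mul_div_comm, mul_comm ((L : ℝ) ^ d) (L : ℝ), div_self (by positivity)]
  linarith [mul_nonneg (div_nonneg hLd.le hL0.le) ht]

/-- **THE SINGLE-BACKGROUND `ℓ¹` NORM OF THE TOWER** (from the positive majorant of `NE3QbarIterMajorant` ∕ `NE7MajorantL1`): in the multi-level class,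
`Σ_{z∈[0,P)^d}Σ_κ ‖QbarIter L (j+1) W Y z κ‖ ≤ Π_{i≤j} (L∕L^d + d·wlin(x_i)·c_loc) · dirL1 Y (periodBox (P·L^{j+1}))` for a `(P·L^{j+1})`-periodic `Y`. [folklore] -/
theorem sum_norm_QbarIter_le_prod [Nonempty n] {L : ℕ} (hL : 1 ≤ L) (j : ℕ) {P : ℕ} [NeZero P]
    {W : Site d → Fin d → (Matrix n n ℂ)ˣ} {x : ℝ} (hWu : IsUnitaryCfg W) (hx : 0 ≤ x) (hs : LevelSmall d L j x) (hWx : SmallField W x)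
    {Y : Site d → Fin d → Matrix n n ℂ} (hYP : IsPeriodicDir Y ((P * L ^ (j + 1) : ℕ) : ℤ)) :
    ∑ z ∈ periodBox (d := d) P, ∑ κ : Fin d, ‖QbarIter L (j + 1) W Y z κ‖
      ≤ (∏ i ∈ Finset.range (j + 1), ((L : ℝ) / (L : ℝ) ^ d
            + (d : ℝ) * wlin d L ((prop1Radius d L)^[i] x) * (1250 * ((nbRad d L : ℝ) + L) + 8 * ((d : ℝ) * L) + 2 * L)))
        * dirL1 Y (periodBox (d := d) (P * L ^ (j + 1))) := by
  set ω : Site d → Fin d → ℝ := fun y μ => ‖Y y μ‖ with hω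
  have hω0 : ∀ (y : Site d) (μ : Fin d), 0 ≤ ω y μ := fun y μ => norm_nonneg _
  have hωP : ∀ (y : Site d) (i : Fin d) (μ : Fin d), ω (y + ((P * L ^ (j + 1) : ℕ) : ℤ) • e i) μ = ω y μ := fun y i μ => by
    simp only [hω, hYP y i μ]
  have hdom : ∀ (y : Site d) (μ : Fin d), ‖Y y μ‖ ≤ ω y μ := fun y μ => le_rfl
  have hW := norm_QbarIter_le_majIter hL j hWu hx hs hWx hdom
  have htower := sum_periodBox_majIter_le (d := d) hL (j + 1) P x hx ω hω0 hωP
  have hS : ∑ y ∈ periodBox (d := d) (P * L ^ (j + 1)), ∑ μ : Fin d, ω y μ = dirL1 Y (periodBox (d := d) (P * L ^ (j + 1))) := rfl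
  rw [hS] at htower
  exact (Finset.sum_le_sum fun z _ => Finset.sum_le_sum fun κ _ => hW z κ).trans htower

/-- **THE ONE-LEVEL SINGLE-BACKGROUND `ℓ¹` NORM**: `Σ_{z∈[0,P)^d}Σ_κ ‖Qbar L W Y z κ‖ ≤ (L∕L^d + d·wlin(x)·c_loc)·dirL1 Y (periodBox (P·L))` in the class
(`twoLevelSmall·x ≤ 1`), `Y` `(P·L)`-periodic. [folklore] -/
theorem sum_norm_Qbar_le_gamma [Nonempty n] {L : ℕ} (hL : 1 ≤ L) {P : ℕ} [NeZero P]
    {W : Site d → Fin d → (Matrix n n ℂ)ˣ} {x : ℝ} (hWu : IsUnitaryCfg W) (hx : 0 ≤ x) (hs : twoLevelSmall d L * x ≤ 1) (hWx : SmallField W x)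
    {Y : Site d → Fin d → Matrix n n ℂ} (hYP : IsPeriodicDir Y ((P * L : ℕ) : ℤ)) :
    ∑ z ∈ periodBox (d := d) P, ∑ κ : Fin d, ‖Qbar L W Y z κ‖
      ≤ ((L : ℝ) / (L : ℝ) ^ d + (d : ℝ) * wlin d L x * (1250 * ((nbRad d L : ℝ) + L) + 8 * ((d : ℝ) * L) + 2 * L))
        * dirL1 Y (periodBox (d := d) (P * L)) := by
  have hs0 : LevelSmall d L 0 x := hs
  have hYP' : IsPeriodicDir Y ((P * L ^ (0 + 1) : ℕ) : ℤ) := by rw [zero_add, pow_one]; exact hYP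
  have h := sum_norm_QbarIter_le_prod hL 0 hWu hx hs0 hWx hYP'
  simp only [zero_add, Finset.prod_range_one, Function.iterate_zero, id, pow_one] at h
  simpa only [QbarIter_one] using h

/-! ## §2 THE TOWER LETTER -/

/-- **THE `ℓ¹` BASE-LIPSCHITZ LETTER OF THE STRAIGHT TOWER AT A CURVED BACKGROUND** (statement in the module docstring, §2): the Grönwall over the levels,
inner-first, with F67's one-level letter at the bottom pair and `NE7MajorantL1`'s single-background norms for the rest. [folklore] -/
theorem sum_norm_QbarIter_sub_QbarIter_le [Nonempty n] {L : ℕ} (hL : 1 ≤ L) (j : ℕ) :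
    ∀ {N : ℕ} [NeZero N] {U W : Site d → Fin d → (Matrix n n ℂ)ˣ} {x : ℝ},
      IsUnitaryCfg U → IsUnitaryCfg W → 0 ≤ x → LevelSmall d L j x → SmallField U x → SmallField W x →
      IsPeriodicCfg U ((N * L ^ (j + 1) : ℕ) : ℤ) → IsPeriodicCfg W ((N * L ^ (j + 1) : ℕ) : ℤ) →
    ∀ {r : ℕ → ℝ}, (∀ i, 0 ≤ r i) →
      (∀ i, i ≤ j → ∀ (y : Site d) (μ : Fin d),
        ‖(((cavgIter L i W y μ)⁻¹ * cavgIter L i U y μ : (Matrix n n ℂ)ˣ) : Matrix n n ℂ) - 1‖ ≤ r i) →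
    ∀ {Y : Site d → Fin d → Matrix n n ℂ}, IsPeriodicDir Y ((N * L ^ (j + 1) : ℕ) : ℤ) →
      ∑ z ∈ periodBox (d := d) N, ∑ κ : Fin d, ‖QbarIter L (j + 1) U Y z κ - QbarIter L (j + 1) W Y z κ‖
        ≤ (((L : ℝ) ^ d / L)
            * (∏ i ∈ Finset.range (j + 1), ((L : ℝ) / (L : ℝ) ^ d
                + (d : ℝ) * wlin d L ((prop1Radius d L)^[i] x) * (1250 * ((nbRad d L : ℝ) + L) + 8 * ((d : ℝ) * L) + 2 * L)))
            * (∑ i ∈ Finset.range (j + 1), (d : ℝ) * (2 * nbRad d L + 1) ^ d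
                * ((2 * (d : ℝ) + 4) * (L : ℝ) ^ 2 * (2 * ((nbRad d L : ℝ) * (prop1Radius d L)^[i] x) + r i)
                    + (8 * (L : ℝ) + (1250 * ((nbRad d L : ℝ) + L) + 8 * (d * L) + 2 * L))
                        * (loopRad d L ((prop1Radius d L)^[i] x) + loopRad d L ((prop1Radius d L)^[i] x)))))
          * dirL1 Y (periodBox (d := d) (N * L ^ (j + 1))) := by
  -- abbreviations (the one-level constants as functions of the radius)
  have hcloc0 : (0 : ℝ) ≤ 1250 * ((nbRad d L : ℝ) + L) + 8 * ((d : ℝ) * L) + 2 * L := by positivity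
  induction j with
  | zero =>
      intro N _ U W x hUu hWu hx hs hUx hWx hUP hWP r hr0 hr Y hYP
      obtain ⟨h512, -, -, -⟩ := step_small hL hWu hx hs hWx
      have hN : 1 ≤ N := Nat.one_le_iff_ne_zero.mpr (NeZero.ne N)
      have hYP' : IsPeriodicDir Y ((L : ℤ) * N) := by
        have e : ((N * L ^ (0 + 1) : ℕ) : ℤ) = (L : ℤ) * N := by push_cast; ring
        rw [e] at hYP; exact hYP
      have hr00 : ∀ (y : Site d) (μ : Fin d), ‖(((W y μ)⁻¹ * U y μ : (Matrix n n ℂ)ˣ) : Matrix n n ℂ) - 1‖ ≤ r 0 := by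
        intro y μ
        have h := hr 0 le_rfl y μ
        simp only [AveragingDeficitMultiLevelPrep.cavgIter] at h
        exact h
      have h1 := sum_norm_Qbar_sub_Qbar_le hL hN hUu hWu hx hx h512 h512 hUx hWx (hr0 0) hr00 Y hYP'
      have hD0 : 0 ≤ dirL1 Y (periodBox (d := d) (N * L ^ (0 + 1))) := by
        unfold dirL1; exact Finset.sum_nonneg fun _ _ => Finset.sum_nonneg fun _ _ => norm_nonneg _
      have hbox : periodBox (d := d) (L * N) = periodBox (d := d) (N * L ^ (0 + 1)) := by rw [zero_add, pow_one, Nat.mul_comm]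
      rw [hbox] at h1
      simp only [zero_add, Finset.prod_range_one, Finset.sum_range_one, Function.iterate_zero, id, QbarIter_one]
      refine h1.trans ?_
      set lam : ℝ := (d : ℝ) * (2 * nbRad d L + 1) ^ d
          * ((2 * (d : ℝ) + 4) * (L : ℝ) ^ 2 * (2 * ((nbRad d L : ℝ) * x) + r 0)
              + (8 * (L : ℝ) + (1250 * ((nbRad d L : ℝ) + L) + 8 * (d * L) + 2 * L)) * (loopRad d L x + loopRad d L x)) with hlam
      have hl0 : 0 ≤ loopRad d L x := by unfold loopRad; positivity
      have hlam0 : 0 ≤ lam := by rw [hlam]; have := hr0 0; positivity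
      have hγ := one_le_invq_mul_gamma (d := d) hL (t := (d : ℝ) * wlin d L x * (1250 * ((nbRad d L : ℝ) + L) + 8 * ((d : ℝ) * L) + 2 * L))
        (mul_nonneg (mul_nonneg (Nat.cast_nonneg _) (wlin_nonneg d L hx)) hcloc0)
      calc lam * dirL1 Y (periodBox (d := d) (N * L ^ (0 + 1)))
          = 1 * lam * dirL1 Y (periodBox (d := d) (N * L ^ (0 + 1))) := by ring
        _ ≤ (((L : ℝ) ^ d / L) * ((L : ℝ) / (L : ℝ) ^ d + (d : ℝ) * wlin d L x * (1250 * ((nbRad d L : ℝ) + L) + 8 * ((d : ℝ) * L) + 2 * L)))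
              * lam * dirL1 Y (periodBox (d := d) (N * L ^ (0 + 1))) :=
            mul_le_mul_of_nonneg_right (mul_le_mul_of_nonneg_right hγ hlam0) hD0
        _ = _ := by simp only [zero_add]
  | succ j ih =>
      intro N _ U W x hUu hWu hx hs hUx hWx hUP hWP r hr0 hr Y hYP
      obtain ⟨h512, hU₁u, hx₁, hU₁x⟩ := step_small hL hUu hx hs.1 hUx
      obtain ⟨-, hW₁u, -, hW₁x⟩ := step_small hL hWu hx hs.1 hWx
      haveI : NeZero (N * L ^ (j + 1)) := ⟨Nat.mul_ne_zero (NeZero.ne N) (pow_ne_zero _ (by omega))⟩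
      have hM : 1 ≤ N * L ^ (j + 1) := Nat.one_le_iff_ne_zero.mpr (NeZero.ne _)
      -- period bookkeeping
      have ecast : ((N * L ^ (j + 1 + 1) : ℕ) : ℤ) = (L : ℤ) * ((N * L ^ (j + 1) : ℕ) : ℤ) := by push_cast; ring
      have hUP' : IsPeriodicCfg U ((L : ℤ) * ((N * L ^ (j + 1) : ℕ) : ℤ)) := by rw [← ecast]; exact hUP
      have hWP' : IsPeriodicCfg W ((L : ℤ) * ((N * L ^ (j + 1) : ℕ) : ℤ)) := by rw [← ecast]; exact hWP
      have hYP' : IsPeriodicDir Y ((L : ℤ) * ((N * L ^ (j + 1) : ℕ) : ℤ)) := by rw [← ecast]; exact hYP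
      have hU₁P : IsPeriodicCfg (cavg L U) ((N * L ^ (j + 1) : ℕ) : ℤ) := isPeriodicCfg_cavg L (N * L ^ (j + 1)) hUP'
      have hW₁P : IsPeriodicCfg (cavg L W) ((N * L ^ (j + 1) : ℕ) : ℤ) := isPeriodicCfg_cavg L (N * L ^ (j + 1)) hWP'
      have hQUP : IsPeriodicDir (Qbar L U Y) ((N * L ^ (j + 1) : ℕ) : ℤ) := fun z i κ => Qbar_add_period L hUP' hYP' z i κ
      have hQWP : IsPeriodicDir (Qbar L W Y) ((N * L ^ (j + 1) : ℕ) : ℤ) := fun z i κ => Qbar_add_period L hWP' hYP' z i κ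
      -- the one-level objects
      set Φ : Site d → Fin d → Matrix n n ℂ := fun y μ => Qbar L U Y y μ - Qbar L W Y y μ with hΦ
      have hΦP : IsPeriodicDir Φ ((N * L ^ (j + 1) : ℕ) : ℤ) := fun z i κ => by simp only [hΦ, hQUP z i κ, hQWP z i κ]
      -- the relative radii of the averaged pair shift by one level
      have hr' : ∀ i, i ≤ j → ∀ (y : Site d) (μ : Fin d),
          ‖(((cavgIter L i (cavg L W) y μ)⁻¹ * cavgIter L i (cavg L U) y μ : (Matrix n n ℂ)ˣ) : Matrix n n ℂ) - 1‖ ≤ r (i + 1) := by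
        intro i hi y μ
        have h := hr (i + 1) (by omega) y μ
        rw [cavgIter_succ, cavgIter_succ] at h
        exact h
      -- (a) the first term: the tower at `Ū` applied to `Φ`
      have hA := sum_norm_QbarIter_le_prod hL j hU₁u hx₁ hs.2 hU₁x hΦP
      have hΦ1 : dirL1 Φ (periodBox (d := d) (N * L ^ (j + 1)))
          = ∑ z ∈ periodBox (d := d) (N * L ^ (j + 1)), ∑ κ : Fin d, ‖Qbar L U Y z κ - Qbar L W Y z κ‖ := rfl
      have hr00 : ∀ (y : Site d) (μ : Fin d), ‖(((W y μ)⁻¹ * U y μ : (Matrix n n ℂ)ˣ) : Matrix n n ℂ) - 1‖ ≤ r 0 := by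
        intro y μ
        have h := hr 0 (Nat.zero_le _) y μ
        simp only [AveragingDeficitMultiLevelPrep.cavgIter] at h
        exact h
      have hone := sum_norm_Qbar_sub_Qbar_le hL hM hUu hWu hx hx h512 h512 hUx hWx (hr0 0) hr00 Y hYP'
      have hbox : periodBox (d := d) (L * (N * L ^ (j + 1))) = periodBox (d := d) (N * L ^ (j + 1 + 1)) := by
        congr 1; ring
      rw [hbox] at hone
      -- (b) the second term: the induction hypothesis at the averaged pair applied to `Q̄_W Y`
      have hB := ih hU₁u hW₁u hx₁ hs.2 hU₁x hW₁x hU₁P hW₁P (r := fun i => r (i + 1)) (fun i => hr0 (i + 1)) hr' hQWP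
      have hQW1 := sum_norm_Qbar_le_gamma hL hWu hx hs.1 hWx (P := N * L ^ (j + 1)) (Y := Y)
        (by rw [show ((N * L ^ (j + 1) * L : ℕ) : ℤ) = ((N * L ^ (j + 1 + 1) : ℕ) : ℤ) by push_cast; ring]; exact hYP)
      have hbox' : periodBox (d := d) (N * L ^ (j + 1) * L) = periodBox (d := d) (N * L ^ (j + 1 + 1)) := by
        congr 1; ring
      rw [hbox'] at hQW1
      -- (c) the split `Q̄^{(j+2)}_U Y − Q̄^{(j+2)}_W Y = Q̄^{(j+1)}_{Ū} Φ + (Q̄^{(j+1)}_{Ū} − Q̄^{(j+1)}_{W̄})(Q̄_W Y)`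
      have hsplit : ∀ (z : Site d) (κ : Fin d),
          QbarIter L (j + 1 + 1) U Y z κ - QbarIter L (j + 1 + 1) W Y z κ
            = QbarIter L (j + 1) (cavg L U) Φ z κ
              + (QbarIter L (j + 1) (cavg L U) (Qbar L W Y) z κ - QbarIter L (j + 1) (cavg L W) (Qbar L W Y) z κ) := by
        intro z κ
        have hadd := QbarIter_add hL j hU₁u hx₁ hs.2 hU₁x Φ (Qbar L W Y)
        have hfun : (fun y μ => Φ y μ + Qbar L W Y y μ) = Qbar L U Y := by
          funext y μ; simp only [hΦ, sub_add_cancel]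
        rw [hfun] at hadd
        rw [QbarIter_succ L (j + 1) U Y, QbarIter_succ L (j + 1) W Y, hadd]
        exact add_sub_assoc _ _ _
      -- (d) assemble
      set D : ℝ := dirL1 Y (periodBox (d := d) (N * L ^ (j + 1 + 1))) with hD
      have hD0 : 0 ≤ D := by rw [hD]; unfold dirL1; exact Finset.sum_nonneg fun _ _ => Finset.sum_nonneg fun _ _ => norm_nonneg _
      set c : ℝ := 1250 * ((nbRad d L : ℝ) + L) + 8 * ((d : ℝ) * L) + 2 * L with hc
      set γ : ℕ → ℝ := fun i => (L : ℝ) / (L : ℝ) ^ d + (d : ℝ) * wlin d L ((prop1Radius d L)^[i] x) * c with hγ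
      set lam : ℕ → ℝ := fun i => (d : ℝ) * (2 * nbRad d L + 1) ^ d
          * ((2 * (d : ℝ) + 4) * (L : ℝ) ^ 2 * (2 * ((nbRad d L : ℝ) * (prop1Radius d L)^[i] x) + r i)
              + (8 * (L : ℝ) + (1250 * ((nbRad d L : ℝ) + L) + 8 * (d * L) + 2 * L))
                  * (loopRad d L ((prop1Radius d L)^[i] x) + loopRad d L ((prop1Radius d L)^[i] x))) with hlam
      have hxi : ∀ i, 0 ≤ (prop1Radius d L)^[i] x := fun i => iterate_prop1Radius_nonneg (d := d) L i hx
      have hγ0 : ∀ i, 0 ≤ γ i := fun i => by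
        simp only [hγ]; exact add_nonneg (by positivity) (mul_nonneg (mul_nonneg (Nat.cast_nonneg _) (wlin_nonneg d L (hxi i))) hcloc0)
      have hlam0 : ∀ i, 0 ≤ lam i := fun i => by
        have h1 := hxi i; have h2 := hr0 i
        have h3 : 0 ≤ loopRad d L ((prop1Radius d L)^[i] x) := by unfold loopRad; positivity
        simp only [hlam]; positivity
      -- the two products ∕ sums at the averaged level are the shifted ones
      have hshiftg : ∀ i, (L : ℝ) / (L : ℝ) ^ d + (d : ℝ) * wlin d L ((prop1Radius d L)^[i] (prop1Radius d L x)) * c = γ (i + 1) := by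
        intro i; simp only [hγ, Function.iterate_succ_apply]
      have hshiftl : ∀ i, (d : ℝ) * (2 * nbRad d L + 1) ^ d
          * ((2 * (d : ℝ) + 4) * (L : ℝ) ^ 2 * (2 * ((nbRad d L : ℝ) * (prop1Radius d L)^[i] (prop1Radius d L x)) + r (i + 1))
              + (8 * (L : ℝ) + (1250 * ((nbRad d L : ℝ) + L) + 8 * (d * L) + 2 * L))
                  * (loopRad d L ((prop1Radius d L)^[i] (prop1Radius d L x)) + loopRad d L ((prop1Radius d L)^[i] (prop1Radius d L x))))
            = lam (i + 1) := by
        intro i; simp only [hlam, Function.iterate_succ_apply]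
      set PA : ℝ := ∏ i ∈ Finset.range (j + 1), γ (i + 1) with hPA
      set SA : ℝ := ∑ i ∈ Finset.range (j + 1), lam (i + 1) with hSA
      have hPA0 : 0 ≤ PA := by rw [hPA]; exact Finset.prod_nonneg fun i _ => hγ0 _
      have hSA0 : 0 ≤ SA := by rw [hSA]; exact Finset.sum_nonneg fun i _ => hlam0 _
      have hAeq : (∏ i ∈ Finset.range (j + 1), ((L : ℝ) / (L : ℝ) ^ d
            + (d : ℝ) * wlin d L ((prop1Radius d L)^[i] (prop1Radius d L x)) * (1250 * ((nbRad d L : ℝ) + L) + 8 * ((d : ℝ) * L) + 2 * L))) = PA := by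
        rw [hPA]; exact Finset.prod_congr rfl fun i _ => hshiftg i
      have hBeq1 : (∏ i ∈ Finset.range (j + 1), ((L : ℝ) / (L : ℝ) ^ d
            + (d : ℝ) * wlin d L ((prop1Radius d L)^[i] (prop1Radius d L x)) * (1250 * ((nbRad d L : ℝ) + L) + 8 * ((d : ℝ) * L) + 2 * L))) = PA := hAeq
      have hBeq2 : (∑ i ∈ Finset.range (j + 1), (d : ℝ) * (2 * nbRad d L + 1) ^ d
          * ((2 * (d : ℝ) + 4) * (L : ℝ) ^ 2 * (2 * ((nbRad d L : ℝ) * (prop1Radius d L)^[i] (prop1Radius d L x)) + r (i + 1))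
              + (8 * (L : ℝ) + (1250 * ((nbRad d L : ℝ) + L) + 8 * (d * L) + 2 * L))
                  * (loopRad d L ((prop1Radius d L)^[i] (prop1Radius d L x)) + loopRad d L ((prop1Radius d L)^[i] (prop1Radius d L x))))) = SA := by
        rw [hSA]; exact Finset.sum_congr rfl fun i _ => hshiftl i
      rw [hAeq] at hA
      rw [hBeq1, hBeq2] at hB
      -- target in the abbreviations
      have htarget : (((L : ℝ) ^ d / L)
            * (∏ i ∈ Finset.range (j + 1 + 1), ((L : ℝ) / (L : ℝ) ^ d + (d : ℝ) * wlin d L ((prop1Radius d L)^[i] x) * c))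
            * (∑ i ∈ Finset.range (j + 1 + 1), (d : ℝ) * (2 * nbRad d L + 1) ^ d
                * ((2 * (d : ℝ) + 4) * (L : ℝ) ^ 2 * (2 * ((nbRad d L : ℝ) * (prop1Radius d L)^[i] x) + r i)
                    + (8 * (L : ℝ) + (1250 * ((nbRad d L : ℝ) + L) + 8 * (d * L) + 2 * L))
                        * (loopRad d L ((prop1Radius d L)^[i] x) + loopRad d L ((prop1Radius d L)^[i] x)))))
          = ((L : ℝ) ^ d / L) * (PA * γ 0) * (SA + lam 0) := by
        rw [Finset.prod_range_succ', Finset.sum_range_succ']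
      rw [htarget]
      -- the estimate
      have hq1 := one_le_invq_mul_gamma (d := d) hL (t := (d : ℝ) * wlin d L x * c)
        (mul_nonneg (mul_nonneg (Nat.cast_nonneg _) (wlin_nonneg d L hx)) hcloc0)
      have hγ0' : ((L : ℝ) / (L : ℝ) ^ d + (d : ℝ) * wlin d L x * c) = γ 0 := by simp only [hγ, Function.iterate_zero, id]
      rw [hγ0'] at hq1 hQW1
      have hlam0' : (d : ℝ) * (2 * nbRad d L + 1) ^ d
          * ((2 * (d : ℝ) + 4) * (L : ℝ) ^ 2 * (2 * ((nbRad d L : ℝ) * x) + r 0)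
              + (8 * (L : ℝ) + (1250 * ((nbRad d L : ℝ) + L) + 8 * (d * L) + 2 * L)) * (loopRad d L x + loopRad d L x)) = lam 0 := by
        simp only [hlam, Function.iterate_zero, id]
      rw [hlam0'] at hone
      calc ∑ z ∈ periodBox (d := d) N, ∑ κ : Fin d, ‖QbarIter L (j + 1 + 1) U Y z κ - QbarIter L (j + 1 + 1) W Y z κ‖
          ≤ ∑ z ∈ periodBox (d := d) N, ∑ κ : Fin d, (‖QbarIter L (j + 1) (cavg L U) Φ z κ‖
              + ‖QbarIter L (j + 1) (cavg L U) (Qbar L W Y) z κ - QbarIter L (j + 1) (cavg L W) (Qbar L W Y) z κ‖) :=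
            Finset.sum_le_sum fun z _ => Finset.sum_le_sum fun κ _ => by rw [hsplit]; exact norm_add_le _ _
        _ = (∑ z ∈ periodBox (d := d) N, ∑ κ : Fin d, ‖QbarIter L (j + 1) (cavg L U) Φ z κ‖)
            + ∑ z ∈ periodBox (d := d) N, ∑ κ : Fin d,
                ‖QbarIter L (j + 1) (cavg L U) (Qbar L W Y) z κ - QbarIter L (j + 1) (cavg L W) (Qbar L W Y) z κ‖ := by
            simp only [Finset.sum_add_distrib]
        _ ≤ PA * dirL1 Φ (periodBox (d := d) (N * L ^ (j + 1)))
            + ((L : ℝ) ^ d / L) * PA * SA * dirL1 (Qbar L W Y) (periodBox (d := d) (N * L ^ (j + 1))) := add_le_add hA hB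
        _ ≤ PA * (lam 0 * D) + ((L : ℝ) ^ d / L) * PA * SA * (γ 0 * D) := by
            refine add_le_add (mul_le_mul_of_nonneg_left ?_ hPA0)
              (mul_le_mul_of_nonneg_left ?_ (mul_nonneg (mul_nonneg (by positivity) hPA0) hSA0))
            · rw [hΦ1]; exact hone
            · exact hQW1
        _ ≤ ((L : ℝ) ^ d / L) * γ 0 * (PA * (lam 0 * D)) + ((L : ℝ) ^ d / L) * PA * SA * (γ 0 * D) :=
            add_le_add (le_mul_of_one_le_left (mul_nonneg hPA0 (mul_nonneg (hlam0 0) hD0)) hq1) le_rfl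
        _ = ((L : ℝ) ^ d / L) * (PA * γ 0) * (SA + lam 0) * D := by ring

/-! ## §3 The tower letter with the `j`-free constant -/

/-- **THE TOWER LETTER WITH `K_maj`**: for `L ≥ 2`, under the data of §2,
`Σ_{z∈[0,N)^d}Σ_κ ‖QbarIter L (j+1) U Y − QbarIter L (j+1) W Y‖(z,κ) ≤ K_maj(d,L)·(L∕L^d)^j·(Σ_{i≤j} λ(r_i, x_i))·dirL1 Y (periodBox (N·L^{j+1}))`,
`K_maj = exp((L^d∕L)·d·wlin-slope·c_loc·2∕twoLevelSmall)` (`NE7MajorantL1.prod_step_le`). [folklore] -/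
theorem sum_norm_QbarIter_sub_QbarIter_le_Kmaj [Nonempty n] {L : ℕ} (hL : 2 ≤ L) (j : ℕ) {N : ℕ} [NeZero N]
    {U W : Site d → Fin d → (Matrix n n ℂ)ˣ} {x : ℝ} (hUu : IsUnitaryCfg U) (hWu : IsUnitaryCfg W) (hx : 0 ≤ x) (hs : LevelSmall d L j x)
    (hUx : SmallField U x) (hWx : SmallField W x) (hUP : IsPeriodicCfg U ((N * L ^ (j + 1) : ℕ) : ℤ)) (hWP : IsPeriodicCfg W ((N * L ^ (j + 1) : ℕ) : ℤ))
    {r : ℕ → ℝ} (hr0 : ∀ i, 0 ≤ r i)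
    (hr : ∀ i, i ≤ j → ∀ (y : Site d) (μ : Fin d), ‖(((cavgIter L i W y μ)⁻¹ * cavgIter L i U y μ : (Matrix n n ℂ)ˣ) : Matrix n n ℂ) - 1‖ ≤ r i)
    {Y : Site d → Fin d → Matrix n n ℂ} (hYP : IsPeriodicDir Y ((N * L ^ (j + 1) : ℕ) : ℤ)) :
    ∑ z ∈ periodBox (d := d) N, ∑ κ : Fin d, ‖QbarIter L (j + 1) U Y z κ - QbarIter L (j + 1) W Y z κ‖
      ≤ (Real.exp (((L : ℝ) ^ d / L) * ((d : ℝ) * (16 * ((d : ℝ) + 1) * ((d : ℝ) + 4) * (L : ℝ) ^ 2)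
              * (1250 * ((nbRad d L : ℝ) + L) + 8 * ((d : ℝ) * L) + 2 * L)) * (2 / twoLevelSmall d L))
          * ((L : ℝ) / (L : ℝ) ^ d) ^ j
          * (∑ i ∈ Finset.range (j + 1), (d : ℝ) * (2 * nbRad d L + 1) ^ d
              * ((2 * (d : ℝ) + 4) * (L : ℝ) ^ 2 * (2 * ((nbRad d L : ℝ) * (prop1Radius d L)^[i] x) + r i)
                  + (8 * (L : ℝ) + (1250 * ((nbRad d L : ℝ) + L) + 8 * (d * L) + 2 * L))
                      * (loopRad d L ((prop1Radius d L)^[i] x) + loopRad d L ((prop1Radius d L)^[i] x)))))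
        * dirL1 Y (periodBox (d := d) (N * L ^ (j + 1))) := by
  have hL1 : 1 ≤ L := by omega
  have hL0 : (0 : ℝ) < L := by exact_mod_cast (show 0 < L by omega)
  have h := sum_norm_QbarIter_sub_QbarIter_le (d := d) hL1 j hUu hWu hx hs hUx hWx hUP hWP hr0 hr hYP
  have hK := prod_step_le (d := d) hL j hx hs
  refine h.trans (mul_le_mul_of_nonneg_right ?_ ?_)
  · have hS0 : 0 ≤ ∑ i ∈ Finset.range (j + 1), (d : ℝ) * (2 * nbRad d L + 1) ^ d
          * ((2 * (d : ℝ) + 4) * (L : ℝ) ^ 2 * (2 * ((nbRad d L : ℝ) * (prop1Radius d L)^[i] x) + r i)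
              + (8 * (L : ℝ) + (1250 * ((nbRad d L : ℝ) + L) + 8 * (d * L) + 2 * L))
                  * (loopRad d L ((prop1Radius d L)^[i] x) + loopRad d L ((prop1Radius d L)^[i] x))) := by
      refine Finset.sum_nonneg fun i _ => ?_
      have h1 := iterate_prop1Radius_nonneg (d := d) L i hx; have h2 := hr0 i
      have h3 : 0 ≤ loopRad d L ((prop1Radius d L)^[i] x) := by unfold loopRad; positivity
      positivity
    have hq : ((L : ℝ) ^ d / L) * ((L : ℝ) / (L : ℝ) ^ d) ^ (j + 1) = ((L : ℝ) / (L : ℝ) ^ d) ^ j := by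
      rw [pow_succ, ← mul_assoc, mul_comm ((L : ℝ) ^ d / L), mul_assoc, div_mul_div_comm, mul_comm (L : ℝ) ((L : ℝ) ^ d),
        div_self (by positivity), mul_one]
    calc ((L : ℝ) ^ d / L) * (∏ i ∈ Finset.range (j + 1), ((L : ℝ) / (L : ℝ) ^ d
            + (d : ℝ) * wlin d L ((prop1Radius d L)^[i] x) * (1250 * ((nbRad d L : ℝ) + L) + 8 * ((d : ℝ) * L) + 2 * L))) * _
        ≤ ((L : ℝ) ^ d / L) * (Real.exp (((L : ℝ) ^ d / L) * ((d : ℝ) * (16 * ((d : ℝ) + 1) * ((d : ℝ) + 4) * (L : ℝ) ^ 2)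
              * (1250 * ((nbRad d L : ℝ) + L) + 8 * ((d : ℝ) * L) + 2 * L)) * (2 / twoLevelSmall d L))
            * ((L : ℝ) / (L : ℝ) ^ d) ^ (j + 1)) * _ :=
          mul_le_mul_of_nonneg_right (mul_le_mul_of_nonneg_left hK (by positivity)) hS0
      _ = _ := by rw [← hq]; ring
  · unfold dirL1; exact Finset.sum_nonneg fun _ _ => Finset.sum_nonneg fun _ _ => norm_nonneg _

end

end Summit.QuantumFields.BalabanUV.T4Continuum.NE7QbarCurvedBaseTower
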